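import Summits.CriticalPhenomena.PercolationContinuityZ3.Theorems.SahiBoxTP2Real

/-!
# Gibbs densities with submodular potential (ferromagnetic pair couplings, Gaussians with M-matrix precision)
# are box-TP₂ on `ℝ^d`

Support file of the Sahi cell (`prim-sahi`, typer seat, generation 11; `--supports stmt-CriticalPhenomena-4575`).

* `IsBoxTP2.withDensity_pi_exp_neg` — if `V : ℝ^d → ℝ` is measurable and SUBMODULAR
  (`V(x ∨ y) + V(x ∧ y) ≤ V(x) + V(y)`), the Gibbs law `e^{-V} · ⊗_j μ_j` is box-TP₂ for any σ-finite reference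
  measures `μ_j` on `ℝ` (`e^{-V}` is MTP₂; `SahiBoxTP2Real.IsBoxTP2.withDensity_pi`);
* `mul_add_mul_le_sup_mul_sup_add_inf_mul_inf` — the two-point rearrangement `ac + be ≤ (a∨b)(c∨e) + (a∧b)(c∧e)`;
* `sum_sum_mul_submodular` — a quadratic form `Σ_{ij} P_ij u_i u_j` with NONPOSITIVE OFF-DIAGONAL coefficients is
  submodular on `ℝ^d`; `quadPotential P m φ x = Σ_{ij} P_ij (x_i − m_i)(x_j − m_j) + Σ_i φ_i(x_i)` (centre `m`,
  arbitrary separable part `φ`) is submodular (`quadPotential_submodular`) and measurable;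
* **`IsBoxTP2.withDensity_pi_quadPotential`** — so `exp(−quadPotential P m φ) · ⊗_j μ_j` is box-TP₂: Gaussian vectors
  `N(m, Σ)` whose precision matrix `Σ⁻¹ = 2P` has nonpositive off-diagonal entries (M-matrices), with Lebesgue
  reference; their discrete / one-sided / tilted analogues with other product references;
* `msahiE_withDensity_pi_exp_neg_nonneg_of_liebSahiContinuum` — hence Sahi-positive of order `n` given `L(d,n)`
  (bounded measurable monotone families), unconditionally for `d ≤ 2` / `n ≤ 2`; the cell `(≤3,3)` is in
  `SahiBoxTP2SubmodularThree.lean` (computational certificate inside).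

`MTP₂` of Gaussians with M-matrix precision is [folklore] (Karlin–Rinott 1980/1983); the `E_n` consequences are this
work.  No sorries, no new axioms.
-/

noncomputable section

namespace Summit.CriticalPhenomena.PercolationContinuityZ3.Theorems.SahiBoxTP2

open MeasureTheory ProbabilityTheory Set Filter Topology Function Literature.Combinatorics.Sahi2008
open scoped ENNReal unitInterval

variable {d n : ℕ}

/-! ### Submodular potentials give box-TP₂ Gibbs laws -/

/-- **Gibbs densities `e^{-V}` with submodular `V` are box-TP₂** w.r.t. any product of σ-finite reference measures
on `ℝ^d`. [folklore] -/
theorem IsBoxTP2.withDensity_pi_exp_neg (μ : Fin d → Measure ℝ) [∀ i, SigmaFinite (μ i)] {V : (Fin d → ℝ) → ℝ}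
    (hVm : Measurable V) (hV : ∀ x y, V (x ⊔ y) + V (x ⊓ y) ≤ V x + V y) :
    IsBoxTP2 ((Measure.pi μ).withDensity fun x => ENNReal.ofReal (Real.exp (-V x))) := by
  refine IsBoxTP2.withDensity_pi μ _ (ENNReal.measurable_ofReal.comp (Real.measurable_exp.comp hVm.neg))
    fun x y => ?_
  rw [← ENNReal.ofReal_mul (Real.exp_pos _).le, ← ENNReal.ofReal_mul (Real.exp_pos _).le, ← Real.exp_add,
    ← Real.exp_add]
  exact ENNReal.ofReal_le_ofReal (Real.exp_le_exp.2 (by linarith [hV x y]))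

/-! ### Quadratic forms with nonpositive off-diagonal coefficients are submodular -/

/-- **Two-point rearrangement**: `ac + be ≤ (a ∨ b)(c ∨ e) + (a ∧ b)(c ∧ e)` for reals. [folklore] -/
theorem mul_add_mul_le_sup_mul_sup_add_inf_mul_inf (a b c e : ℝ) :
    a * c + b * e ≤ (a ⊔ b) * (c ⊔ e) + (a ⊓ b) * (c ⊓ e) := by
  rcases le_total a b with hab | hab <;> rcases le_total c e with hce | hce
  · rw [sup_eq_right.2 hab, sup_eq_right.2 hce, inf_eq_left.2 hab, inf_eq_left.2 hce]
    all_goals linarith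
  · rw [sup_eq_right.2 hab, sup_eq_left.2 hce, inf_eq_left.2 hab, inf_eq_right.2 hce]
    nlinarith [mul_nonneg (sub_nonneg.2 hab) (sub_nonneg.2 hce)]
  · rw [sup_eq_left.2 hab, sup_eq_right.2 hce, inf_eq_right.2 hab, inf_eq_left.2 hce]
    nlinarith [mul_nonneg (sub_nonneg.2 hab) (sub_nonneg.2 hce)]
  · rw [sup_eq_left.2 hab, sup_eq_left.2 hce, inf_eq_right.2 hab, inf_eq_right.2 hce]

/-- **A quadratic form with nonpositive off-diagonal coefficients is submodular on `ℝ^d`.** [folklore] -/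
theorem sum_sum_mul_submodular (P : Fin d → Fin d → ℝ) (hP : ∀ i j, i ≠ j → P i j ≤ 0) (a b : Fin d → ℝ) :
    (∑ i, ∑ j, P i j * (a ⊔ b) i * (a ⊔ b) j) + (∑ i, ∑ j, P i j * (a ⊓ b) i * (a ⊓ b) j) ≤
      (∑ i, ∑ j, P i j * a i * a j) + ∑ i, ∑ j, P i j * b i * b j := by
  rw [← sub_nonpos]
  have h : (∑ i, ∑ j, P i j * (a ⊔ b) i * (a ⊔ b) j) + (∑ i, ∑ j, P i j * (a ⊓ b) i * (a ⊓ b) j) -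
      ((∑ i, ∑ j, P i j * a i * a j) + ∑ i, ∑ j, P i j * b i * b j) =
      ∑ i, ∑ j, P i j * ((a ⊔ b) i * (a ⊔ b) j + (a ⊓ b) i * (a ⊓ b) j - a i * a j - b i * b j) := by
    rw [← Finset.sum_add_distrib, ← Finset.sum_add_distrib, ← Finset.sum_sub_distrib]
    refine Finset.sum_congr rfl fun i _ => ?_
    rw [← Finset.sum_add_distrib, ← Finset.sum_add_distrib, ← Finset.sum_sub_distrib]
    exact Finset.sum_congr rfl fun j _ => by ring
  rw [h]
  refine Finset.sum_nonpos fun i _ => Finset.sum_nonpos fun j _ => ?_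
  by_cases hij : i = j
  · subst hij
    have h0 : (a ⊔ b) i * (a ⊔ b) i + (a ⊓ b) i * (a ⊓ b) i - a i * a i - b i * b i = 0 := by
      simp only [Pi.sup_apply, Pi.inf_apply]
      rcases le_total (a i) (b i) with h | h
      · rw [sup_eq_right.2 h, inf_eq_left.2 h]; ring
      · rw [sup_eq_left.2 h, inf_eq_right.2 h]; ring
    rw [h0, mul_zero]
  · refine mul_nonpos_iff.2 (Or.inr ⟨hP i j hij, ?_⟩)
    simp only [Pi.sup_apply, Pi.inf_apply]
    linarith [mul_add_mul_le_sup_mul_sup_add_inf_mul_inf (a i) (b i) (a j) (b j)]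

/-- **Quadratic potential** with coupling matrix `P`, centre `m` and separable part `φ`:
`V(x) = Σ_{ij} P_ij (x_i − m_i)(x_j − m_j) + Σ_i φ_i(x_i)`.  For `P = Σ⁻¹/2` and `φ = const` this is (up to the
normalising constant) the negative log-density of the Gaussian `N(m, Σ)`. [folklore] -/
def quadPotential (P : Fin d → Fin d → ℝ) (m : Fin d → ℝ) (φ : Fin d → ℝ → ℝ) (x : Fin d → ℝ) : ℝ :=
  (∑ i, ∑ j, P i j * (x i - m i) * (x j - m j)) + ∑ i, φ i (x i)

/-- The quadratic potential is measurable (for measurable `φ_i`). [folklore] -/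
theorem measurable_quadPotential (P : Fin d → Fin d → ℝ) (m : Fin d → ℝ) {φ : Fin d → ℝ → ℝ}
    (hφ : ∀ i, Measurable (φ i)) : Measurable (quadPotential P m φ) := by
  refine Measurable.add (Finset.measurable_sum _ fun i _ => Finset.measurable_sum _ fun j _ => ?_)
    (Finset.measurable_sum _ fun i _ => (hφ i).comp (measurable_pi_apply i))
  exact ((measurable_const.mul ((measurable_pi_apply i).sub measurable_const)).mul
    ((measurable_pi_apply j).sub measurable_const))

/-- **Quadratic potentials with nonpositive off-diagonal couplings are submodular** (any centre, any separable
part). [folklore] -/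
theorem quadPotential_submodular {P : Fin d → Fin d → ℝ} (hP : ∀ i j, i ≠ j → P i j ≤ 0) (m : Fin d → ℝ)
    (φ : Fin d → ℝ → ℝ) (x y : Fin d → ℝ) :
    quadPotential P m φ (x ⊔ y) + quadPotential P m φ (x ⊓ y) ≤ quadPotential P m φ x + quadPotential P m φ y := by
  set A : Fin d → ℝ := fun i => x i - m i with hA
  set B : Fin d → ℝ := fun i => y i - m i with hB
  have hsup : ∀ i, (x ⊔ y) i - m i = (A ⊔ B) i := fun i => by
    simp only [hA, hB, Pi.sup_apply]
    rcases le_total (x i) (y i) with h | h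
    · rw [sup_eq_right.2 h, sup_eq_right.2 (sub_le_sub_right h _)]
    · rw [sup_eq_left.2 h, sup_eq_left.2 (sub_le_sub_right h _)]
  have hinf : ∀ i, (x ⊓ y) i - m i = (A ⊓ B) i := fun i => by
    simp only [hA, hB, Pi.inf_apply]
    rcases le_total (x i) (y i) with h | h
    · rw [inf_eq_left.2 h, inf_eq_left.2 (sub_le_sub_right h _)]
    · rw [inf_eq_right.2 h, inf_eq_right.2 (sub_le_sub_right h _)]
  have hφ : ∑ i, φ i ((x ⊔ y) i) + ∑ i, φ i ((x ⊓ y) i) = ∑ i, φ i (x i) + ∑ i, φ i (y i) := by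
    rw [← Finset.sum_add_distrib, ← Finset.sum_add_distrib]
    refine Finset.sum_congr rfl fun i _ => ?_
    simp only [Pi.sup_apply, Pi.inf_apply]
    rcases le_total (x i) (y i) with h | h
    · rw [sup_eq_right.2 h, inf_eq_left.2 h, add_comm]
    · rw [sup_eq_left.2 h, inf_eq_right.2 h]
  have hq := sum_sum_mul_submodular P hP A B
  simp only [quadPotential, hsup, hinf]
  have eA : (∑ i, ∑ j, P i j * (x i - m i) * (x j - m j)) = ∑ i, ∑ j, P i j * A i * A j := rfl
  have eB : (∑ i, ∑ j, P i j * (y i - m i) * (y j - m j)) = ∑ i, ∑ j, P i j * B i * B j := rfl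
  rw [eA, eB]
  linarith

/-- **Gaussian-type Gibbs laws with M-matrix couplings are box-TP₂**: for `P` with nonpositive off-diagonal
entries, any centre `m`, measurable separable part `φ` and any σ-finite product reference measure,
`exp(−quadPotential P m φ) · ⊗_j μ_j` is box-TP₂ (Lebesgue reference, `φ` constant: the Gaussians `N(m, (2P)⁻¹)`
with M-matrix precision). [folklore] -/
theorem IsBoxTP2.withDensity_pi_quadPotential (μ : Fin d → Measure ℝ) [∀ i, SigmaFinite (μ i)]
    {P : Fin d → Fin d → ℝ} (hP : ∀ i j, i ≠ j → P i j ≤ 0) (m : Fin d → ℝ) {φ : Fin d → ℝ → ℝ}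
    (hφ : ∀ i, Measurable (φ i)) :
    IsBoxTP2 ((Measure.pi μ).withDensity fun x => ENNReal.ofReal (Real.exp (-quadPotential P m φ x))) :=
  IsBoxTP2.withDensity_pi_exp_neg μ (measurable_quadPotential P m hφ) (quadPotential_submodular hP m φ)

/-! ### Sahi positivity -/

/-- **Gibbs laws with submodular potential on `ℝ^d` are Sahi-positive of order `n` given `L(d,n)`** (bounded
measurable nonnegative monotone families; the law normalised to a probability measure). [this work] -/
theorem msahiE_withDensity_pi_exp_neg_nonneg_of_liebSahiContinuum (h : LiebSahiContinuum d n)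
    (μ : Fin d → Measure ℝ) [∀ i, SigmaFinite (μ i)] {V : (Fin d → ℝ) → ℝ} (hVm : Measurable V)
    (hV : ∀ x y, V (x ⊔ y) + V (x ⊓ y) ≤ V x + V y)
    [IsProbabilityMeasure ((Measure.pi μ).withDensity fun x => ENNReal.ofReal (Real.exp (-V x)))]
    (f : Fin n → (Fin d → ℝ) → ℝ) (hfm : ∀ i, Measurable (f i)) (hf0 : ∀ i x, 0 ≤ f i x) {M : ℝ}
    (hfM : ∀ i x, f i x ≤ M) (hmono : ∀ i, Monotone (f i)) :
    0 ≤ msahiE ((Measure.pi μ).withDensity fun x => ENNReal.ofReal (Real.exp (-V x))) n f :=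
  msahiE_nonneg_of_isBoxTP2_real h _ (IsBoxTP2.withDensity_pi_exp_neg μ hVm hV) f hfm hf0 hfM hmono

/-- **Unconditionally on `ℝ²`** (and `ℝ`): Gibbs laws with submodular potential are Sahi-positive of every order
for bounded measurable monotone families. [this work] -/
theorem msahiE_withDensity_pi_exp_neg_nonneg_of_le_two (hd : d ≤ 2) (μ : Fin d → Measure ℝ)
    [∀ i, SigmaFinite (μ i)] {V : (Fin d → ℝ) → ℝ} (hVm : Measurable V)
    (hV : ∀ x y, V (x ⊔ y) + V (x ⊓ y) ≤ V x + V y)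
    [IsProbabilityMeasure ((Measure.pi μ).withDensity fun x => ENNReal.ofReal (Real.exp (-V x)))] (n : ℕ)
    (f : Fin n → (Fin d → ℝ) → ℝ) (hfm : ∀ i, Measurable (f i)) (hf0 : ∀ i x, 0 ≤ f i x) {M : ℝ}
    (hfM : ∀ i x, f i x ≤ M) (hmono : ∀ i, Monotone (f i)) :
    0 ≤ msahiE ((Measure.pi μ).withDensity fun x => ENNReal.ofReal (Real.exp (-V x))) n f :=
  msahiE_withDensity_pi_exp_neg_nonneg_of_liebSahiContinuum (liebSahiContinuum_of_le_two hd n) μ hVm hV f hfm hf0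
    hfM hmono

end Summit.CriticalPhenomena.PercolationContinuityZ3.Theorems.SahiBoxTP2
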